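import Mathlib
import Summits.NavierStokesRegularity.NavierStokesRegularity.Theorems.TypeIQuarterGateScarEnvelopeTypeISatelliteTowerRecurrentEnemies

/-!
# Satellite tower for crux `ScarEnvelopeTypeI` (stmt-NavierStokesRegularity-23843) — Part Y6–Y8: TRANSPORT of self-blow-up / self-descent / root-recurrence to the doubly-minimal representative; BOTH ENEMIES ARE DOUBLY-MINIMAL

Part Y6–Y8 of nsreg-p3's ROUND-43 artefact (section `Transport`, answer to ref3 g27's ROUND-42 F1): Y6 ★★ `zoom_congr_ae`, `exists_tangentU_rep`,
`RootBlowup.rep`, `RootDescends.rep`, `IsRootOmegaLimit.congr_ae_self` (quasi-measure-preserving parabolic dilation + compactness along a subsequence +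
uniqueness of L³ limits; no pressure-determination lemma); Y7 ★★★ `DoublyMin.tameSelfBlowup_or_selfDescending` (both enemies are doubly-minimal
objects IN THEIR OWN DATA); Y8 ★★★ `twoEnemies_of_not_scarEnvelopeTypeI`, ★★ `scarEnvelopeTypeI_of_noTriplyMinLeaf_noSelfDescendingDoublyMin`
(23843 ⟸ «no triply-minimal object is a one-scar leaf» ∧ «no doubly-minimal object root-descends to itself»).

PROVENANCE: declaration texts VERBATIM from the HOME artefact of the instrument seat nsreg-p3 g27 (cell `pub/ns-regularity-ideate`):
`round-43/Enemy43.lean` (sha16 `f4e9849cbe2eaa96`, NEW part `partY.lean` f195bf0010977c73 = partY1/partY2/partY3; a module written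
against the TREE; memo `round-43/ROUND-43.md` bdd83fd98f0e4a52), scored by referee ref3 g27 (`SCORE-p3-ROUND-43-0828.md`); the author cannot write under `Theorems/`
(`perm.theorems-prover-only`); landed by the prover ns-es-p1 g5 as landing hand of record (director-ns DIRECTOR-NS #237 (3)), split into
≤ 400-line modules, `E3` spelled out, the artefact's `#guard_msgs … #print axioms` certificates not landed.
`--supports stmt-NavierStokesRegularity-23843 --as helper`.

HONEST FRAMING: instrument theorems about HYPOTHETICAL Type-I zoom limits (Albritton–Barker objects of the census of crux
`TypeIQuarterGate.ScarEnvelopeTypeI`, item 23843); the analytic input is the tree's closure engine (compactness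
`local_typeI_compactness_twin_inBall`, sharpened to constant 1 in Part S1; Q1 whole-space), P1 rate inheritance, L8 persistence and the
tree's PROVED small-constant Liouville theorem; Parts R/S are order theory on the re-classing and closure lemmas.  NOTHING OPEN IS
PROVED: 23843, (L′) `TypeILiouvilleAB` / (L′₀), the GLOBAL (S∞) = `CritAttained`, (M𝐈₁), (E1⁺), (E2ᵣ), route ExtremalTypeIConstant's
cruxes, N0 and Navier–Stokes regularity are OPEN; `critRate`, `levelCrit I`, `liouvilleRate` are `sInf`s that are `0` by junk value
when the defining set is empty (every statement using them carries the nonemptiness hypothesis explicitly).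
-/

-- the summit-side namespace repeats a component by design (single-conjunct summit, D-0017)
set_option linter.dupNamespace false

open MeasureTheory Set Metric Filter Topology
open scoped ENNReal NNReal InnerProductSpace
open Literature.Analysis.FluidPDE

namespace Summit.NavierStokesRegularity.NavierStokesRegularity.Cruxes.ScarEnvelopeTypeI.ZoomDictionary

/-! ### Part Y6 — TRANSPORT OF SELF-BLOW-UP, SELF-DESCENT AND ROOT-RECURRENCE TO THE DOUBLY-MINIMAL
REPRESENTATIVE (answer to ref3 g27's ROUND-42 finding F1)

`TangentU` quantifies the limit pressure EXISTENTIALLY and `RootBlowup` / `RootDescends` / `IsRootOmegaLimit`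
allow ANY null (sub)sequence of scales, so NO pressure-determination lemma is needed: the parabolic dilation is
quasi-measure-preserving (`map_stAffine_volume_restrict_preimage`), hence zooms of a.e.-equal fields are
a.e. equal (Y6a); a tangent of the representative along a SUBSEQUENCE of the old scales exists by the tree's
compactness (`exists_tangentU_along`) and equals the old tangent a.e. by uniqueness of `L³` limits (Y6c). -/

section Transport

variable {U V U' : ℝ → (EuclideanSpace ℝ (Fin 3)) → (EuclideanSpace ℝ (Fin 3))} {P P' : ℝ → (EuclideanSpace ℝ (Fin 3)) → ℝ}
  {H H' : ℝ → (EuclideanSpace ℝ (Fin 3)) → (EuclideanSpace ℝ (Fin 3)) →L[ℝ] (EuclideanSpace ℝ (Fin 3))} {M m : ℝ}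

/-- Y6a. **Zooms of a.e.-equal fields are a.e. equal** (on every window, at every centre and scale). -/
theorem zoom_congr_ae
    (hae : ∀ R : ℝ, 0 < R →
      ∀ᵐ z ∂(volume.restrict (parabolicCylinder R (0 : ℝ × (EuclideanSpace ℝ (Fin 3))))), U z.1 z.2 = V z.1 z.2)
    (y : (EuclideanSpace ℝ (Fin 3))) {ρ : ℝ} (hρ : 0 < ρ) {R : ℝ} (hR : 0 < R) :
    ∀ᵐ z ∂(volume.restrict (parabolicCylinder R (0 : ℝ × (EuclideanSpace ℝ (Fin 3))))),
      zoom U y 0 ρ z.1 z.2 = zoom V y 0 ρ z.1 z.2 := by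
  have hsub : parabolicCylinder (ρ * R) (((0 : ℝ), y) : ℝ × (EuclideanSpace ℝ (Fin 3))) ⊆
      parabolicCylinder (‖y‖ + ρ * R) (0 : ℝ × (EuclideanSpace ℝ (Fin 3))) :=
    parabolicCylinder_subset_zero (pow_le_pow_left₀ (by positivity)
      (by linarith [norm_nonneg y]) 2) le_rfl
  have hg : (Function.uncurry U) =ᵐ[volume.restrict (parabolicCylinder (ρ * R) (((0 : ℝ), y) : ℝ × (EuclideanSpace ℝ (Fin 3))))]
      (Function.uncurry V) :=
    (ae_restrict_of_ae_restrict_of_subset hsub (hae (‖y‖ + ρ * R) (by positivity))).mono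
      fun z hz => hz
  have hqmp : Measure.QuasiMeasurePreserving (stAffine (ρ ^ 2) ρ 0 y)
      (volume.restrict (stAffine (ρ ^ 2) ρ 0 y ⁻¹'
        parabolicCylinder (ρ * R) (((0 : ℝ), y) : ℝ × (EuclideanSpace ℝ (Fin 3)))))
      (volume.restrict (parabolicCylinder (ρ * R) (((0 : ℝ), y) : ℝ × (EuclideanSpace ℝ (Fin 3))))) := by
    refine ⟨measurable_stAffine _ _ _ _, ?_⟩
    rw [map_stAffine_volume_restrict_preimage (pow_pos hρ 2) hρ]
    exact Measure.smul_absolutelyContinuous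
  have h2 := hqmp.ae_eq hg
  rw [preimage_zoomAt hρ y R] at h2
  exact h2.mono fun z hz => by
    have eU : zoom U y 0 ρ z.1 z.2 = ρ • (Function.uncurry U ∘ stAffine (ρ ^ 2) ρ 0 y) z := rfl
    have eV : zoom V y 0 ρ z.1 z.2 = ρ • (Function.uncurry V ∘ stAffine (ρ ^ 2) ρ 0 y) z := rfl
    rw [eU, eV, hz]

/-- Y6b. `ZoomsTendsto` is a.e.-invariant in the SOURCE field. -/
theorem ZoomsTendsto.congr_source_ae {x : ℕ → (EuclideanSpace ℝ (Fin 3))} {l : ℕ → ℝ} {W : ℝ → (EuclideanSpace ℝ (Fin 3)) → (EuclideanSpace ℝ (Fin 3))}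
    (h : ZoomsTendsto U x l W) (hl : ∀ j, 0 < l j)
    (hae : ∀ R : ℝ, 0 < R →
      ∀ᵐ z ∂(volume.restrict (parabolicCylinder R (0 : ℝ × (EuclideanSpace ℝ (Fin 3))))), U z.1 z.2 = V z.1 z.2) :
    ZoomsTendsto V x l W := by
  intro R hR
  refine (h R hR).congr fun j => eLpNorm_congr_ae ?_
  exact (zoom_congr_ae hae (x j) (hl j) hR).mono fun z hz => by
    show zoom U (x j) 0 (l j) z.1 z.2 - W z.1 z.2 = zoom V (x j) 0 (l j) z.1 z.2 - W z.1 z.2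
    rw [hz]

/-- Y6b'. **Root-recurrence is a.e.-invariant**: if `U` is a root ω-limit of itself and `V = U` a.e. on every
window, then `V` is a root ω-limit of itself (along the same scales). -/
theorem IsRootOmegaLimit.congr_ae_self (h : IsRootOmegaLimit U U)
    (hae : ∀ R : ℝ, 0 < R →
      ∀ᵐ z ∂(volume.restrict (parabolicCylinder R (0 : ℝ × (EuclideanSpace ℝ (Fin 3))))), U z.1 z.2 = V z.1 z.2) :
    IsRootOmegaLimit V V := by
  obtain ⟨hL3, l, hl, hl0, hz⟩ := h
  refine ⟨fun R hR => (hL3 R hR).ae_eq ((hae R hR).mono fun z hz => hz), l, hl, hl0, fun R hR => ?_⟩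
  have h1 : ZoomsTendsto V (fun _ => 0) l U := ZoomsTendsto.congr_source_ae hz hl hae
  refine (h1 R hR).congr fun j => eLpNorm_congr_ae ?_
  exact (hae R hR).mono fun z hz => by
    show zoom V 0 0 (l j) z.1 z.2 - U z.1 z.2 = zoom V 0 0 (l j) z.1 z.2 - V z.1 z.2
    rw [hz]

/-- Y6c. **A tangent of the representative.**  If `Ū` is a root tangent of the A–B field `U` along `L` and
`U'` is an A–B field a.e. equal to `U` on every window, then along a SUBSEQUENCE `L ∘ φ` the datum `(U', P')`
has a root tangent `Ū'` (its limit pressure supplied by the tree's compactness), and `Ū' = Ū` a.e. on every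
`Q_R(0)`, `R < 1` (zooms agree a.e., `L³` limits are unique). -/
theorem exists_tangentU_rep {L : ℕ → ℝ} {Ū : ℝ → (EuclideanSpace ℝ (Fin 3)) → (EuclideanSpace ℝ (Fin 3))}
    (hT : TangentU U P 0 0 L Ū) (hU : ABTower M U P H) (hAB : ABTower m U' P' H')
    (hae : ∀ R : ℝ, 0 < R →
      ∀ᵐ z ∂(volume.restrict (parabolicCylinder R (0 : ℝ × (EuclideanSpace ℝ (Fin 3))))), U' z.1 z.2 = U z.1 z.2) :
    ∃ φ : ℕ → ℕ, StrictMono φ ∧ ∃ Ū' : ℝ → (EuclideanSpace ℝ (Fin 3)) → (EuclideanSpace ℝ (Fin 3)), TangentU U' P' 0 0 (L ∘ φ) Ū' ∧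
      ∀ R ∈ Ioo (0 : ℝ) 1,
        ∀ᵐ z ∂(volume.restrict (parabolicCylinder R (0 : ℝ × (EuclideanSpace ℝ (Fin 3))))), Ū' z.1 z.2 = Ū z.1 z.2 := by
  obtain ⟨hL, hL0, pbar, hTR⟩ := hT
  obtain ⟨φ, hφ, Ū', hT'⟩ := exists_tangentU_along (towerObj_of_abTower hAB) 0 hL hL0
  refine ⟨φ, hφ, Ū', hT', fun R hR => ?_⟩
  obtain ⟨-, -, pbar', hTR'⟩ := hT'
  obtain ⟨-, hŪ'3, hconv', -⟩ := hTR' R hR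
  obtain ⟨-, hŪ3, hconv, -⟩ := hTR R hR
  have hconvU : Tendsto (fun k => eLpNorm
      (Function.uncurry (zoom U 0 0 ((L ∘ φ) k)) - Function.uncurry Ū) 3
      (volume.restrict (parabolicCylinder R (0 : ℝ × (EuclideanSpace ℝ (Fin 3)))))) atTop (𝓝 0) :=
    hconv.comp hφ.tendsto_atTop
  have hconvU' : Tendsto (fun k => eLpNorm
      (Function.uncurry (zoom U 0 0 ((L ∘ φ) k)) - Function.uncurry Ū') 3
      (volume.restrict (parabolicCylinder R (0 : ℝ × (EuclideanSpace ℝ (Fin 3)))))) atTop (𝓝 0) := by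
    refine hconv'.congr fun k => eLpNorm_congr_ae ?_
    exact (zoom_congr_ae hae 0 (hL (φ k)) hR.1).mono fun z hz => by
      show zoom U' 0 0 (L (φ k)) z.1 z.2 - Ū' z.1 z.2 = zoom U 0 0 (L (φ k)) z.1 z.2 - Ū' z.1 z.2
      rw [hz]
  have hmeas : ∀ k, AEStronglyMeasurable (Function.uncurry (zoom U 0 0 ((L ∘ φ) k)))
      (volume.restrict (parabolicCylinder R (0 : ℝ × (EuclideanSpace ℝ (Fin 3))))) := fun k =>
    aestronglyMeasurable_uncurry_zoom (fun R' hR' => hU.aestronglyMeasurable_uncurry hR') 0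
      (hL (φ k)) hR.1
  exact (ae_eq_of_tendsto_eLpNorm_three hmeas hŪ'3.1 hŪ3.1 hconvU' hconvU).mono fun z hz => hz

/-- Y6d. **SELF-BLOW-UP TRANSPORTS TO THE REPRESENTATIVE**: if the A–B node `n` is a root blow-up of
itself and `U'` is an A–B field a.e. equal to `n.U` on every window, then the node `⟨U', P', H', y⟩` is a root
blow-up of itself (along a subsequence of `n`'s scales). -/
theorem RootBlowup.rep {n : TNode} (hb : RootBlowup n n) (hn : ABTower M n.U n.P n.H)
    (hAB : ABTower m U' P' H')
    (hae : ∀ R : ℝ, 0 < R →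
      ∀ᵐ z ∂(volume.restrict (parabolicCylinder R (0 : ℝ × (EuclideanSpace ℝ (Fin 3))))), U' z.1 z.2 = n.U z.1 z.2)
    (y : (EuclideanSpace ℝ (Fin 3))) : RootBlowup ⟨U', P', H', y⟩ ⟨U', P', H', y⟩ := by
  obtain ⟨L, Ū, hT, hŪ⟩ := hb
  obtain ⟨φ, hφ, Ū', hT', hŪ'⟩ := exists_tangentU_rep hT hn hAB hae
  refine ⟨L ∘ φ, Ū', hT', fun R hR => ?_⟩
  filter_upwards [hŪ' R hR, hŪ R hR, hae R hR.1] with z h1 h2 h3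
  show Ū' z.1 z.2 = U' z.1 z.2
  rw [h1, h2]
  exact h3.symm

/-- Y6e. **SELF-DESCENT TRANSPORTS TO THE REPRESENTATIVE** (ref3 R42 F1; corrects R42's c51 / R43's c60
«not claimed»): if the A–B node `n` root-descends to itself and `U'` is an A–B field a.e. equal to `n.U` on
every window, then `n̂ = ⟨U', P', H', n.y⟩` root-descends to itself — the satellite clause transfers through
`regPt_iff_of_ae_eq_of_norm_lt_one` (`‖n.y‖ = 1/4 < 1`). -/
theorem RootDescends.rep {n : TNode} (hd : RootDescends n n) (hn : ABTower M n.U n.P n.H)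
    (hAB : ABTower m U' P' H')
    (hae : ∀ R : ℝ, 0 < R →
      ∀ᵐ z ∂(volume.restrict (parabolicCylinder R (0 : ℝ × (EuclideanSpace ℝ (Fin 3))))), U' z.1 z.2 = n.U z.1 z.2) :
    RootDescends ⟨U', P', H', n.y⟩ ⟨U', P', H', n.y⟩ := by
  obtain ⟨L, Ū, hT, hŪ, hny, hsat⟩ := hd
  obtain ⟨φ, hφ, Ū', hT', hŪ'⟩ := exists_tangentU_rep hT hn hAB hae
  refine ⟨L ∘ φ, Ū', hT', fun R hR => ?_, hny, hsat.1, fun hreg => hsat.2 ?_⟩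
  · filter_upwards [hŪ' R hR, hŪ R hR, hae R hR.1] with z h1 h2 h3
    show Ū' z.1 z.2 = U' z.1 z.2
    rw [h1, h2]
    exact h3.symm
  · have hy1 : ‖n.y‖ < 1 := by rw [hny]; norm_num
    exact (regPt_iff_of_ae_eq_of_norm_lt_one (fun R hR => hae R hR.1) hy1).1 hreg

/-- Y6f. **A SELF-DESCENDING ROOTED OBJECT IS NOT TAME** (Y2: tame + self blow-up ⇒ one-scar leaf, but the
self-descent puts a satellite at radius `1/4`). -/
theorem RootObj.not_tameRoot_of_selfDescends {n : TNode} (hn : RootObj M n) (hd : RootDescends n n) :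
    ¬ TameRoot n := by
  intro hb
  obtain ⟨A, -, hleaf⟩ := hn.envNode_leaf_of_tame_selfBlowup hb hd.rootBlowup
  obtain ⟨L, Ū, -, -, hny, hsat⟩ := hd
  exact hsat.2 (hleaf n.y hsat.1 (by rw [hny]; norm_num))

/-- Y6g. **The doubly-minimal representative of a self-descending rooted node is not tame** (Y6e + Y6f). -/
theorem DoublyMin.rep_not_tameRoot {I : ℝ≥0∞} {n : TNode} {U' : ℝ → (EuclideanSpace ℝ (Fin 3)) → (EuclideanSpace ℝ (Fin 3))} {P' : ℝ → (EuclideanSpace ℝ (Fin 3)) → ℝ}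
    {H' : ℝ → (EuclideanSpace ℝ (Fin 3)) → (EuclideanSpace ℝ (Fin 3)) →L[ℝ] (EuclideanSpace ℝ (Fin 3))}
    (hD : DoublyMin I ⟨U', P', H', n.y⟩) (hd : RootDescends n n) (hn : RootObj M n)
    (hae : ∀ R : ℝ, 0 < R →
      ∀ᵐ z ∂(volume.restrict (parabolicCylinder R (0 : ℝ × (EuclideanSpace ℝ (Fin 3))))), U' z.1 z.2 = n.U z.1 z.2) :
    ¬ TameRoot ⟨U', P', H', n.y⟩ :=
  hD.1.1.not_tameRoot_of_selfDescends (hd.rep hn.1 hD.1.1.1 hae)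

/-! ### Part Y7 — THE TWO ENEMIES IN THEIR OWN DATA -/

/-- ★★★ **Y7. THE TWO RECURRENT ENEMIES, EACH A DOUBLY-MINIMAL OBJECT IN ITS OWN DATUM.**  For every
doubly-minimal object `n₀`: EITHER (tame) some DOUBLY-MINIMAL object of the level, pointed at its root, is TAME,
a ROOT BLOW-UP OF ITSELF, ROOT-RECURRENT, a gallery limit of `n₀.U`, ENVELOPED on its unit window and a
ONE-SCAR LEAF, root rated exactly `M_c(I)`; OR (wild) some DOUBLY-MINIMAL object `n̂` of the level is NOT tame,
ROOT-DESCENDS TO ITSELF (`n̂ ⟶ n̂`: it is a.e. its own root tangent and carries a satellite at `‖n̂.y‖ = 1/4`),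
is ROOT-RECURRENT, a gallery limit of `n₀.U`, with EVERY final-time scar rated exactly `M_c(I)` and
energy-saturated at every scale (Y3 + the transport lemmas Y6b'/Y6d/Y6e). -/
theorem DoublyMin.tameSelfBlowup_or_selfDescending {I : ℝ≥0∞} {n₀ : TNode} (h : DoublyMin I n₀) :
    (∃ (n : TNode) (A : ℝ), DoublyMin I n ∧ TameRoot n ∧ n.y = 0 ∧ RootBlowup n n ∧
        IsRootOmegaLimit n.U n.U ∧ IsGalleryLimit n₀.U n.U ∧ EnvNode A n ∧ LeafNode n ∧
        tightRate n.U 0 = levelCrit I) ∨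
    ∃ n : TNode, DoublyMin I n ∧ ¬ TameRoot n ∧ RootDescends n n ∧ IsRootOmegaLimit n.U n.U ∧
      IsGalleryLimit n₀.U n.U ∧ ‖n.y‖ = 1 / 4 ∧ ¬ RegPt n.U 0 ∧ ¬ RegPt n.U n.y ∧
      (∀ y' : (EuclideanSpace ℝ (Fin 3)), ¬ RegPt n.U y' → tightRate n.U y' = levelCrit I ∧
        ∀ ρ : ℝ, 0 < ρ →
          typeIBound (parabolicCylinder ρ (((0 : ℝ), y') : ℝ × (EuclideanSpace ℝ (Fin 3)))) n.U n.P n.H = minLevel I) := by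
  rcases h.recurrentLeaf_or_selfDescending_rep with
      ⟨n, U', P', H', A, hn, -, hbl, hω, hgal, -, -, hae, hD, hb', hE', hL', -, ht, -, -⟩ |
      ⟨n, U', P', H', hn, -, hd, hω, hgal, hae, hD, hreg, hny, h0, hy, hsat, -⟩
  · have hae' : ∀ R : ℝ, 0 < R →
        ∀ᵐ z ∂(volume.restrict (parabolicCylinder R (0 : ℝ × (EuclideanSpace ℝ (Fin 3))))), n.U z.1 z.2 = U' z.1 z.2 :=
      fun R hR => (hae R hR).mono fun z hz => hz.symm
    exact Or.inl ⟨⟨U', P', H', 0⟩, A, hD, hb', rfl, hbl.rep hn.1 hD.1.1.1 hae 0,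
      hω.congr_ae_self hae', hgal.congr_ae hae', hE', hL', ht⟩
  · have hae' : ∀ R : ℝ, 0 < R →
        ∀ᵐ z ∂(volume.restrict (parabolicCylinder R (0 : ℝ × (EuclideanSpace ℝ (Fin 3))))), n.U z.1 z.2 = U' z.1 z.2 :=
      fun R hR => (hae R hR).mono fun z hz => hz.symm
    exact Or.inr ⟨⟨U', P', H', n.y⟩, hD, (DoublyMin.rep_not_tameRoot hD hd hn hae), hd.rep hn.1 hD.1.1.1 hae,
      hω.congr_ae_self hae', hgal.congr_ae hae', hny, h0, hy,
      fun y' hy' => hsat y' fun hr => hy' ((hreg y').2 hr)⟩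

/-- ★★★ **Y7b. WILD ⇒ A SELF-DESCENDING DOUBLY-MINIMAL OBJECT** (the wild enemy in its own datum). -/
theorem DoublyMin.exists_selfDescending_of_wild {I : ℝ≥0∞} {n₀ : TNode} (h : DoublyMin I n₀)
    (hW : ∀ n : TNode, DoublyMin I n → ¬ TameRoot n) :
    ∃ n : TNode, DoublyMin I n ∧ ¬ TameRoot n ∧ RootDescends n n ∧ IsRootOmegaLimit n.U n.U ∧
      IsGalleryLimit n₀.U n.U ∧ ‖n.y‖ = 1 / 4 ∧ ¬ RegPt n.U 0 ∧ ¬ RegPt n.U n.y ∧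
      (∀ y' : (EuclideanSpace ℝ (Fin 3)), ¬ RegPt n.U y' → tightRate n.U y' = levelCrit I ∧
        ∀ ρ : ℝ, 0 < ρ →
          typeIBound (parabolicCylinder ρ (((0 : ℝ), y') : ℝ × (EuclideanSpace ℝ (Fin 3)))) n.U n.P n.H = minLevel I) := by
  rcases h.tameSelfBlowup_or_selfDescending with ⟨n, A, hD, hb, -⟩ | hR
  · exact absurd hb (hW n hD)
  · exact hR

/-- Y7c. **NO SELF-DESCENDING DOUBLY-MINIMAL OBJECT ⇒ THE TAME RECURRENT LEAF**: if no doubly-minimal object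
of the level root-descends to itself, every doubly-minimal object has among its gallery limits a TAME,
SELF-BLOWN-UP, ROOT-RECURRENT, enveloped, one-scar DOUBLY-MINIMAL leaf (Y7 with the wild alternative excluded). -/
theorem DoublyMin.exists_tameSelfBlowup_of_noSelfDescending {I : ℝ≥0∞} {n₀ : TNode} (h : DoublyMin I n₀)
    (hW : ∀ n : TNode, DoublyMin I n → ¬ RootDescends n n) :
    ∃ (n : TNode) (A : ℝ), DoublyMin I n ∧ TameRoot n ∧ n.y = 0 ∧ RootBlowup n n ∧
      IsRootOmegaLimit n.U n.U ∧ IsGalleryLimit n₀.U n.U ∧ EnvNode A n ∧ LeafNode n ∧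
      tightRate n.U 0 = levelCrit I := by
  rcases h.tameSelfBlowup_or_selfDescending with hL | ⟨n, hD, -, hd, -⟩
  · exact hL
  · exact absurd hd (hW n hD)

/-! ### Part Y8 — THE TWO-ENEMY NORMAL FORM, both enemies doubly minimal in their own data -/

/-- ★★★ **Y8. THE NORMAL FORM OF ¬23843 — AT LEAST ONE OF THE TWO RECURRENT ENEMIES EXISTS, AS A
DOUBLY-MINIMAL OBJECT.**  If 23843 fails then at the finite scar-carrying level `I₀` of the violator (class
`M_c(I₀) ∈ [ε_L, M]`): EITHER (tame enemy) `M_c ≤ A_*`, a TRIPLY-MINIMAL ONE-SCAR LEAF exists AND a TAME,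
SELF-BLOWN-UP (`n ↝ n`), ROOT-RECURRENT, enveloped, one-scar DOUBLY-MINIMAL leaf exists; OR (wild enemy) a
NON-TAME DOUBLY-MINIMAL object which ROOT-DESCENDS TO ITSELF (`n̂ ⟶ n̂`, satellite at `‖n̂.y‖ = 1/4`), is
ROOT-RECURRENT, with every final-time scar rated exactly `M_c(I₀)` and energy-saturated at every scale, exists.
(Y7 applied to any doubly-minimal object of the level, T4; the tame alternative feeds U9–U12.  Unlike Y5 the
two alternatives are not exclusive regimes — both enemies may coexist; Y5 keeps the regime split.) -/
theorem twoEnemies_of_not_scarEnvelopeTypeI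
    (h : ¬ Summit.NavierStokesRegularity.NavierStokesRegularity.Theses.TypeIQuarterGate.ScarEnvelopeTypeI) :
    ∃ (M : ℝ) (I₀ : ℝ≥0∞), I₀ < ⊤ ∧ (levelRates I₀).Nonempty ∧ levelCrit I₀ ∈ Icc epsL M ∧
      minLevel I₀ ≤ I₀ ∧
      ((levelCrit I₀ ≤ minEnv I₀ ∧
          (∃ n : TNode, TriplyMin I₀ n ∧ LeafNode n ∧ tightRate n.U 0 = levelCrit I₀) ∧
          ∃ (n : TNode) (A : ℝ), DoublyMin I₀ n ∧ TameRoot n ∧ n.y = 0 ∧ RootBlowup n n ∧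
            IsRootOmegaLimit n.U n.U ∧ EnvNode A n ∧ LeafNode n ∧ tightRate n.U 0 = levelCrit I₀) ∨
       (∃ n : TNode, DoublyMin I₀ n ∧ ¬ TameRoot n ∧ RootDescends n n ∧ IsRootOmegaLimit n.U n.U ∧
          ‖n.y‖ = 1 / 4 ∧ ¬ RegPt n.U 0 ∧ ¬ RegPt n.U n.y ∧
          (∀ y' : (EuclideanSpace ℝ (Fin 3)), ¬ RegPt n.U y' → tightRate n.U y' = levelCrit I₀ ∧
            ∀ ρ : ℝ, 0 < ρ →
              typeIBound (parabolicCylinder ρ (((0 : ℝ), y') : ℝ × (EuclideanSpace ℝ (Fin 3)))) n.U n.P n.H = minLevel I₀))) := by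
  obtain ⟨M, I₀, hI₀, hne, hIcc, -, -⟩ := exactCritical_of_not_scarEnvelopeTypeI h
  refine ⟨M, I₀, hI₀, hne, hIcc, minLevel_le_self hI₀ hne, ?_⟩
  obtain ⟨n₀, hn₀⟩ := doublyMin_nonempty hI₀ hne
  rcases hn₀.tameSelfBlowup_or_selfDescending with
      ⟨n, A, hD, hb, hy, hbl, hω, -, hE, hL, ht⟩ | ⟨n, hD, hnt, hd, hω, -, hny, h0, hy, hsat⟩
  · exact Or.inl ⟨levelCrit_le_minEnv ⟨n, hD, hb⟩, exists_triplyMin_leaf hI₀ hne ⟨n, hD, hb⟩,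
      n, A, hD, hb, hy, hbl, hω, hE, hL, ht⟩
  · exact Or.inr ⟨n, hD, hnt, hd, hω, hny, h0, hy, hsat⟩

/-- ★★ **Y8b. 23843 FROM THE TWO CLEAN EXCLUSIONS «no triply-minimal object is a one-scar leaf» and «no
doubly-minimal object root-descends to itself»** — both about single DOUBLY-MINIMAL objects in their own data
(no representatives, no chains, no recurrence hypothesis). -/
theorem scarEnvelopeTypeI_of_noTriplyMinLeaf_noSelfDescendingDoublyMin
    (h₁ : ∀ (I : ℝ≥0∞) (n : TNode), TriplyMin I n → ¬ LeafNode n)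
    (h₂ : ∀ (I : ℝ≥0∞) (n : TNode), DoublyMin I n → ¬ RootDescends n n) :
    Summit.NavierStokesRegularity.NavierStokesRegularity.Theses.TypeIQuarterGate.ScarEnvelopeTypeI := by
  by_contra h
  obtain ⟨M, I₀, -, -, -, -, hcase⟩ := twoEnemies_of_not_scarEnvelopeTypeI h
  rcases hcase with ⟨-, ⟨n, hT, hL, -⟩, -⟩ | ⟨n, hD, -, hd, -⟩
  · exact h₁ I₀ n hT hL
  · exact h₂ I₀ n hD hd

/-- Y8c. **The self-descent exclusion alone forces the tame enemy**: if no doubly-minimal object of any level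
root-descends to itself, then ¬23843 produces a triply-minimal one-scar leaf (so 23843 ⟸ (E1⁺)-type leaf
exclusion + this one hypothesis). -/
theorem triplyMinLeaf_of_not_scarEnvelopeTypeI_of_noSelfDescendingDoublyMin
    (h₂ : ∀ (I : ℝ≥0∞) (n : TNode), DoublyMin I n → ¬ RootDescends n n)
    (h : ¬ Summit.NavierStokesRegularity.NavierStokesRegularity.Theses.TypeIQuarterGate.ScarEnvelopeTypeI) :
    ∃ (I₀ : ℝ≥0∞) (n : TNode), I₀ < ⊤ ∧ TriplyMin I₀ n ∧ LeafNode n ∧ tightRate n.U 0 = levelCrit I₀ := by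
  obtain ⟨M, I₀, hI₀, -, -, -, hcase⟩ := twoEnemies_of_not_scarEnvelopeTypeI h
  rcases hcase with ⟨-, ⟨n, hT, hL, ht⟩, -⟩ | ⟨n, hD, -, hd, -⟩
  · exact ⟨I₀, n, hI₀, hT, hL, ht⟩
  · exact absurd hd (h₂ I₀ n hD)

end Transport


end Summit.NavierStokesRegularity.NavierStokesRegularity.Cruxes.ScarEnvelopeTypeI.ZoomDictionary
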